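import Literature.MathematicalPhysics.QuantumFieldTheory.Balaban1983to89.Beta.WilsonVertex

/-!
# `Balaban1983to89.Beta.WilsonVertex2` — THE SECOND-ORDER (SEAGULL) VERTEX OF THE WILSON PLAQUETTE: the exact `(W², B²)` Taylor jet
of the class function `tr U(∂p)` in the parametrisation `U_b = e^{W_b} e^{B_b}` (fluctuation `W`, background `B`), BCH-free, for
two-sorted words of ANY length in ANY normed algebra — one order up from `Beta.WilsonVertex` (the `(W², B¹)` jet)

β sub-cell, row BETA-an3 gen 12, node BETA-an3-g12-P22-RING.  This is the RING-LEVEL foundation of the «(2,2) family» = the an3-owned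
second-order background stencils of the lead's one-step jet data (`Beta.OneStepResolventKernel.JetData.W`, HOME/BETA/AN2.md §13.3 brick
(V), work order C-an2-53 «P4 second-order `W` … [an2 + an1/an3 2-stencils]»); the lattice typing of what is proved here (plaquette sums,
two-bond backgrounds, colour coordinates, `BubbleTable.stencilIns` tables in the format of `Beta.PlaquetteStencilData`, the fluctuation
colour traces under `ColourTrace.Complete`) is the SUCCESSOR node and is NOT done here.

HONEST FRAMING (mandatory, page 1).  «discharging `BetaPertH` makes Bałaban's UV stability UNCONDITIONAL — a real
constructive-QFT result; it is NOT the continuum limit and NOT the Clay problem.»  Gloss (the LEAD's, BETA-SPEC §0; binding): what would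
be made unconditional is the `EventualForm` END STATEMENT of [Balaban1989LargeFieldII] p. 355 under the explicit γ-smallness restrictions
of the kernel binders — «B16's theorem with one hypothesis fewer», never «Theorem 2 as printed», never the continuum limit / mass gap /
Clay.  THIS FILE discharges nothing of `BetaPertH`; it is one algebraic input of the table side of the wall's one-loop binder.

ABSOLUTE RULE (cell charter, verbatim in substance).  No internally-minted statement enters as a cited fact: every hypothesis of every
theorem below is kernel-proved in this package; NOTHING is cited.  The manuscript under audit ([Balaban1985BackgroundPropagators] = B9)
is named only to say which printed objects the algebra refers to (the Wilson action (3.1), `U = U′U₀`, `Re U(∂p) = ½(U(∂p) + U(−∂p))`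
p. 391, the fine Hessian (3.6)–(3.12)); no displayed formula of it is used as a hypothesis.

WHAT IS PROVED (all tags [folklore]: finite noncommutative algebra and one-variable calculus in a Banach algebra).
* §1 THE SECOND-ORDER TRANSPORT FUNCTIONALS of a two-sorted word, with accumulators `β` (= the sum of the background letters already
  traversed) and `c` (= their ordered commutator sum): `ad₂ β c x = ½[β,[β,x]] + ½[c,x]` — the second-order term of the adjoint
  transport `Ad(e^{y₁}⋯e^{y_m}) x` of a letter by its background prefix (BCH: `log(e^{y₁}⋯e^{y_m}) = β + ½c + O(3)`, and
  `Ad = exp ad log`); `twist₂Aux` = their sum over the W-letters (one order above `WilsonVertex.twistAux`); `qtwistAux` /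
  `qtwist₂Aux` = the `B`-linear / `B`-quadratic parts of the second-order term `quad` of the TRANSPORTED fluctuation letters;
  `ctwistAux` = the `B`-linear part of their ordered commutator sum; the ACCUMULATOR-SHIFT LAWS (`…_shift`: an outer background prefix
  acts on each functional by `Ad`, e.g. `qtwistAux β L = qtwistAux 0 L + [β, quad(wpart L)]`).
* §2 THE GRADED FOURTH-ORDER COMPONENTS `quartic`, `P31`, `P22`, `P13` of the ordered product of exponential jets (recursions one order
  above `WilsonVertex.cubic/P21/P12`), the TWO-PARAMETER SCALING LAW `quartic_map_scale` (so `P22` IS the bidegree-`(2,2)` Taylor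
  coefficient) and the extraction of `P22` from three rays.
* §3 THE TRANSPORT FACTORISATION, as RING IDENTITIES (no trace): `P21 = qtwist + quad_W·Z_B`, `P12 = twist₂ + twist·Z_B + Z_W·quad_B`,
  and the object of this file **`P22 = qtwist₂ + qtwist·Z_B + quad_W·quad_B`** (`Z_W = Σ wpart`, `Z_B = Σ bpart`) — the graded shadow
  of the exact factorisation `Π_j e^{z_j} = (Π_i e^{Ad(h_i) x_i}) · (e^{y₁}⋯e^{y_m})` (transported fluctuation letters times the
  background holonomy), proved here by induction on the word, never by BCH.
* §4 THE GRADED FOURTH-ORDER TRACE FORMULA, for every tracial linear `τ`: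
  `τ(P22 L) = τ(Z_W·twist₂) + ½τ(twist²) + τ(qtwist·Z_B) + τ(quad_W·quad_B)` — SECOND-ORDER TRANSPORT + (TRANSPORT)² (together: the
  `B²`-part of the covariant kinetic term `½τ(Z̃_W²)`, `Z̃_W` = the transported curl) + TRANSPORTED SPIN/CURL AGAINST THE BACKGROUND CURL
  + CURL²/SPIN × CURL²/SPIN (`2·quad = Z² + commSum` on both sorts); and `τ(qtwist) = τ(Z_W·twist)`, `2·qtwist = {Z_W, twist} + ctwist`.
* §5 THE WILSON PLAQUETTE WORD: the explicit second-order transport `twist₂_plaq`, the explicit `qtwist_plaq`, the plaquette trace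
  formula, and the CONSTANT-FIELD CHECK `trace_P22_plaq_const`: at constant letters (`W = (X,Y,X,Y)`, `B = (P,Q,P,Q)`) the `(2,2)`-jet
  of `τ U(∂p)` is `½τ(([P,Y] − [Q,X])²) + τ([X,Y]·[P,Q])` — exactly the `(2,2)`-part of `½τ(F²)` with `F = [P + X, Q + Y]`, the
  commutator field strength of the constant connection (the continuum `A²B²` seagull + spin×spin structure, DERIVED from the group product).
* §6 CALCULUS: `D₄`, `HasDerivAt (D₃ l) (D₄ l t) t`, `D₄ l 0 = 24·quartic l` — `quartic` IS one twenty-fourth of the fourth derivative of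
  the transport path of `Beta.TransportVertices` (by name: `holPath`, `D₁`, `D₂`, `D₃`).

NOT PROVED HERE, NOT CLAIMED: any lattice statement (sums over plaquettes / orientations, bond letters, stencil matrices, finite range,
translation covariance — successor node, format requested by an2 journal l.52107: `PlaquetteStencilData`-style site-independent tables,
distinct-bond and contact cases, colour matrix families `m_t(Y,Y′)` and their fluctuation-colour traces `[c = c′]·κ_t`); any colour trace;
any bound (the remainder bounds of `Beta.TransportVertices` §1–§2 apply to these words verbatim); the (V-con)/(V-H) rows, `ℋ⁽²⁾`, (T-def);
anything about `BetaPertH`, the continuum limit or the Clay problem.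

Version v1.0 (gen 12).  GAPS record C-beta-an3-28.  Engine cross-check (exact free-algebra arithmetic, pure python, session folder
`code/p22_design.py`, 93/93 identities incl. every displayed formula below on random words and on the plaquette word): records only.
-/

noncomputable section

namespace Literature.MathematicalPhysics.QuantumFieldTheory.Balaban1983to89.Beta.WilsonVertex2

open NormedSpace
open Literature.MathematicalPhysics.QuantumFieldTheory.Balaban1983to89.Beta.TransportVertices
open Literature.MathematicalPhysics.QuantumFieldTheory.Balaban1983to89.Beta.WilsonVertex
open Literature.MathematicalPhysics.QuantumFieldTheory.Balaban1983to89.Beta.SpinTable (br plaqPairs plaqPairs_local)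

/-! ## §1 Second-order transport functionals of a two-sorted word -/

section Letters

variable {𝔸 : Type*} [Ring 𝔸]

/-- `WilsonVertex.twistAux`, W-letter first, written with `SpinTable.br` (`br β x = βx − xβ`, definitionally). [folklore] -/
theorem twistAux_consW_br (β x : 𝔸) (L : List (Bool × 𝔸)) :
    twistAux β ((true, x) :: L) = br β x + twistAux β L := rfl

/-- `WilsonVertex.twistAux_eq` written with `br`: `twistAux β L = twistAux 0 L + [β, Σ wpart L]`. [folklore] -/
theorem twistAux_shift (β : 𝔸) (L : List (Bool × 𝔸)) :
    twistAux β L = twistAux 0 L + br β (wpart L).sum := twistAux_eq β L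

/-- THE `B`-LINEAR PART OF THE ORDERED COMMUTATOR SUM of the transported fluctuation letters:
`ctwistAux 0 L = Σ_{i<i'} ([A⁽¹⁾_i, x_{i'}] + [x_i, A⁽¹⁾_{i'}])` (the polarisation of `TransportVertices.commSum` at the letters `x_i` in the
direction of their first-order transports `A⁽¹⁾_i = [β_i, x_i]`, `β_i` = the sum of the B-letters preceding `x_i`), accumulator `β`.
[folklore] -/
def ctwistAux : 𝔸 → List (Bool × 𝔸) → 𝔸
  | _, [] => 0
  | β, (true, x) :: L => ctwistAux β L + (br (br β x) (wpart L).sum + br x (twistAux β L))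
  | β, (false, y) :: L => ctwistAux (β + y) L

/-- `ctwistAux` of the empty word. [folklore] -/
@[simp] theorem ctwistAux_nil (β : 𝔸) : ctwistAux β ([] : List (Bool × 𝔸)) = 0 := rfl
/-- `ctwistAux`, W-letter first. [folklore] -/
@[simp] theorem ctwistAux_consW (β x : 𝔸) (L : List (Bool × 𝔸)) :
    ctwistAux β ((true, x) :: L) = ctwistAux β L + (br (br β x) (wpart L).sum + br x (twistAux β L)) := rfl
/-- `ctwistAux`, B-letter first. [folklore] -/
@[simp] theorem ctwistAux_consB (β y : 𝔸) (L : List (Bool × 𝔸)) :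
    ctwistAux β ((false, y) :: L) = ctwistAux (β + y) L := rfl

end Letters

section Transport

variable (𝕜 : Type*) [RCLike 𝕜] {𝔸 : Type*} [NormedRing 𝔸] [NormedAlgebra 𝕜 𝔸]

/-- THE SECOND-ORDER ADJOINT TRANSPORT of a letter `x` by a background prefix with letter sum `β` and ordered commutator sum `c`:
`ad₂ β c x = ½[β,[β,x]] + ½[c,x]` — the second-order term of `Ad(e^{y₁}⋯e^{y_m}) x = x + [β,x] + ad₂ β c x + O(y³)`
(`β = Σ y_j`, `c = Σ_{j<k}[y_j,y_k]`; equivalently `Σ_{j<k}[y_j,[y_k,x]] + ½Σ_j[y_j,[y_j,x]]`).  A definition asserting nothing.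
[folklore] -/
def ad₂ (β c x : 𝔸) : 𝔸 := (2 : 𝕜)⁻¹ • br β (br β x) + (2 : 𝕜)⁻¹ • br c x

/-- `ad₂` is additive in the transported letter. [folklore] -/
theorem ad₂_add (β c x x' : 𝔸) : ad₂ 𝕜 β c (x + x') = ad₂ 𝕜 β c x + ad₂ 𝕜 β c x' := by
  simp only [ad₂, br, mul_add, add_mul, mul_sub, sub_mul, smul_add, smul_sub,
    mul_assoc]
  module

/-- `ad₂` of the zero letter. [folklore] -/
@[simp] theorem ad₂_zero (β c : 𝔸) : ad₂ 𝕜 β c 0 = 0 := by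
  simp [ad₂, br]

/-- `ad₂` of a negated letter. [folklore] -/
theorem ad₂_neg (β c x : 𝔸) : ad₂ 𝕜 β c (-x) = -ad₂ 𝕜 β c x := by
  have h := ad₂_add 𝕜 β c x (-x)
  rw [add_neg_cancel, ad₂_zero] at h
  exact (neg_eq_of_add_eq_zero_right h.symm).symm

/-- with no prefix there is no transport: `ad₂ 0 0 x = 0`. [folklore] -/
@[simp] theorem ad₂_zero_zero (x : 𝔸) : ad₂ 𝕜 0 0 x = 0 := by
  simp [ad₂, br]

/-- THE SECOND-ORDER TWIST SUM with accumulators `(β, c)`: each W-letter `x` contributes `ad₂ β c x`; a B-letter `y` updates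
`(β, c) ↦ (β + y, c + [β, y])` (the letter sum and the ordered commutator sum of the prefix).  `twist₂Aux 0 0 L = Σ_i A⁽²⁾_i`, the sum
of the second-order transports of the fluctuation letters by their background prefixes — one order above `WilsonVertex.twistAux`.
[folklore] -/
def twist₂Aux : 𝔸 → 𝔸 → List (Bool × 𝔸) → 𝔸
  | _, _, [] => 0
  | β, c, (true, x) :: L => ad₂ 𝕜 β c x + twist₂Aux β c L
  | β, c, (false, y) :: L => twist₂Aux (β + y) (c + br β y) L

/-- `twist₂Aux` of the empty word. [folklore] -/
@[simp] theorem twist₂Aux_nil (β c : 𝔸) : twist₂Aux 𝕜 β c ([] : List (Bool × 𝔸)) = 0 := rfl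
/-- `twist₂Aux`, W-letter first. [folklore] -/
@[simp] theorem twist₂Aux_consW (β c x : 𝔸) (L : List (Bool × 𝔸)) :
    twist₂Aux 𝕜 β c ((true, x) :: L) = ad₂ 𝕜 β c x + twist₂Aux 𝕜 β c L := rfl
/-- `twist₂Aux`, B-letter first: the accumulators advance. [folklore] -/
@[simp] theorem twist₂Aux_consB (β c y : 𝔸) (L : List (Bool × 𝔸)) :
    twist₂Aux 𝕜 β c ((false, y) :: L) = twist₂Aux 𝕜 (β + y) (c + br β y) L := rfl

/-- THE `B`-LINEAR PART OF `quad` OF THE TRANSPORTED FLUCTUATION LETTERS (the polarisation of `TransportVertices.quad` at the letters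
`x_i` in the direction of their first-order transports `A⁽¹⁾_i = [β_i, x_i]`):
`qtwistAux 0 L = Σ_{i<i'} (A⁽¹⁾_i x_{i'} + x_i A⁽¹⁾_{i'}) + ½Σ_i (A⁽¹⁾_i x_i + x_i A⁽¹⁾_i)`, with accumulator `β`. [folklore] -/
def qtwistAux : 𝔸 → List (Bool × 𝔸) → 𝔸
  | _, [] => 0
  | β, (true, x) :: L => qtwistAux β L + (br β x * (wpart L).sum + x * twistAux β L)
      + (2 : 𝕜)⁻¹ • (br β x * x + x * br β x)
  | β, (false, y) :: L => qtwistAux (β + y) L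

/-- `qtwistAux` of the empty word. [folklore] -/
@[simp] theorem qtwistAux_nil (β : 𝔸) : qtwistAux 𝕜 β ([] : List (Bool × 𝔸)) = 0 := rfl
/-- `qtwistAux`, W-letter first. [folklore] -/
@[simp] theorem qtwistAux_consW (β x : 𝔸) (L : List (Bool × 𝔸)) :
    qtwistAux 𝕜 β ((true, x) :: L) = qtwistAux 𝕜 β L + (br β x * (wpart L).sum + x * twistAux β L)
      + (2 : 𝕜)⁻¹ • (br β x * x + x * br β x) := rfl
/-- `qtwistAux`, B-letter first. [folklore] -/
@[simp] theorem qtwistAux_consB (β y : 𝔸) (L : List (Bool × 𝔸)) :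
    qtwistAux 𝕜 β ((false, y) :: L) = qtwistAux 𝕜 (β + y) L := rfl

/-- THE `B`-QUADRATIC PART OF `quad` OF THE TRANSPORTED FLUCTUATION LETTERS:
`qtwist₂Aux 0 0 L = Σ_{i<i'} (A⁽²⁾_i x_{i'} + A⁽¹⁾_i A⁽¹⁾_{i'} + x_i A⁽²⁾_{i'}) + ½Σ_i (A⁽²⁾_i x_i + (A⁽¹⁾_i)² + x_i A⁽²⁾_i)`, with
accumulators `(β, c)` as in `twist₂Aux`. [folklore] -/
def qtwist₂Aux : 𝔸 → 𝔸 → List (Bool × 𝔸) → 𝔸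
  | _, _, [] => 0
  | β, c, (true, x) :: L => qtwist₂Aux β c L
      + (ad₂ 𝕜 β c x * (wpart L).sum + br β x * twistAux β L + x * twist₂Aux 𝕜 β c L)
      + (2 : 𝕜)⁻¹ • (ad₂ 𝕜 β c x * x + br β x * br β x + x * ad₂ 𝕜 β c x)
  | β, c, (false, y) :: L => qtwist₂Aux (β + y) (c + br β y) L

/-- `qtwist₂Aux` of the empty word. [folklore] -/
@[simp] theorem qtwist₂Aux_nil (β c : 𝔸) : qtwist₂Aux 𝕜 β c ([] : List (Bool × 𝔸)) = 0 := rfl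
/-- `qtwist₂Aux`, W-letter first. [folklore] -/
@[simp] theorem qtwist₂Aux_consW (β c x : 𝔸) (L : List (Bool × 𝔸)) :
    qtwist₂Aux 𝕜 β c ((true, x) :: L) = qtwist₂Aux 𝕜 β c L
      + (ad₂ 𝕜 β c x * (wpart L).sum + br β x * twistAux β L + x * twist₂Aux 𝕜 β c L)
      + (2 : 𝕜)⁻¹ • (ad₂ 𝕜 β c x * x + br β x * br β x + x * ad₂ 𝕜 β c x) := rfl
/-- `qtwist₂Aux`, B-letter first. [folklore] -/
@[simp] theorem qtwist₂Aux_consB (β c y : 𝔸) (L : List (Bool × 𝔸)) :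
    qtwist₂Aux 𝕜 β c ((false, y) :: L) = qtwist₂Aux 𝕜 (β + y) (c + br β y) L := rfl

/-- `2·qtwist = {Z_W, twist} + ctwist` — the polarised form of `TransportVertices.two_smul_quad` (`2·quad = Z² + commSum`):
the anticommutator of the fluctuation sum with the twist sum, plus the polarised commutator sum. [folklore] -/
theorem two_smul_qtwistAux (β : 𝔸) (L : List (Bool × 𝔸)) :
    (2 : 𝕜) • qtwistAux 𝕜 β L =
      ((wpart L).sum * twistAux β L + twistAux β L * (wpart L).sum) + ctwistAux β L := by
  induction L generalizing β with
  | nil => simp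
  | cons p L ih =>
    obtain ⟨t, z⟩ := p
    cases t
    · rw [qtwistAux_consB, wpart_consB, twistAux_consB, ctwistAux_consB]
      exact ih (β + z)
    · rw [qtwistAux_consW, wpart_consW, twistAux_consW_br, ctwistAux_consW, List.sum_cons, smul_add, smul_add, ih β,
        smul_smul, mul_inv_cancel₀ (two_ne_zero' 𝕜), one_smul, two_smul]
      simp only [br, mul_add, add_mul, mul_sub, sub_mul,
        mul_assoc]
      module

/-- ACCUMULATOR SHIFT for the second-order twist: an outer background prefix `(β, c)` acts by `Ad`:
`twist₂Aux β c L = twist₂Aux 0 0 L + [β, twist L] + ½[β,[β, Z_W]] + ½[c, Z_W]`. [folklore] -/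
theorem twist₂Aux_shift (β c : 𝔸) (L : List (Bool × 𝔸)) :
    twist₂Aux 𝕜 β c L = twist₂Aux 𝕜 0 0 L + br β (twistAux 0 L)
      + (2 : 𝕜)⁻¹ • br β (br β (wpart L).sum) + (2 : 𝕜)⁻¹ • br c (wpart L).sum := by
  induction L generalizing β c with
  | nil => simp [br]
  | cons p L ih =>
    obtain ⟨t, z⟩ := p
    cases t
    · rw [twist₂Aux_consB, twist₂Aux_consB, ih (β + z) (c + br β z), ih (0 + z) (0 + br 0 z), twistAux_consB,
        twistAux_shift (0 + z) L, wpart_consB]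
      simp only [br, mul_add, add_mul, mul_sub, sub_mul, smul_add, smul_sub,
        mul_assoc, zero_mul, mul_zero, sub_zero, zero_add, add_zero, smul_zero]
      module
    · rw [twist₂Aux_consW, twist₂Aux_consW, ih β c, twistAux_consW_br, wpart_consW, List.sum_cons, ad₂_zero_zero, zero_add]
      simp only [ad₂, br, mul_add, add_mul, mul_sub, sub_mul, smul_add, smul_sub,
        mul_assoc, zero_mul, mul_zero, sub_zero, zero_add]
      module

/-- ACCUMULATOR SHIFT for `qtwist`: `qtwistAux β L = qtwistAux 0 L + [β, quad (wpart L)]` (`[β, ·]` is a derivation). [folklore] -/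
theorem qtwistAux_shift (β : 𝔸) (L : List (Bool × 𝔸)) :
    qtwistAux 𝕜 β L = qtwistAux 𝕜 0 L + br β (quad 𝕜 (wpart L)) := by
  induction L generalizing β with
  | nil => simp [br]
  | cons p L ih =>
    obtain ⟨t, z⟩ := p
    cases t
    · rw [qtwistAux_consB, qtwistAux_consB, ih (β + z), ih (0 + z), wpart_consB]
      simp only [br, mul_add, add_mul,
        zero_add]
      module
    · rw [qtwistAux_consW, qtwistAux_consW, ih β, twistAux_shift β L, wpart_consW, quad_cons]
      simp only [br, mul_add, add_mul, mul_sub, sub_mul, smul_add, smul_sub, smul_mul_assoc, mul_smul_comm,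
        mul_assoc, zero_mul, mul_zero, sub_zero, zero_add, add_zero, smul_zero]
      module

/-- ACCUMULATOR SHIFT for `qtwist₂`:
`qtwist₂Aux β c L = qtwist₂Aux 0 0 L + [β, qtwist L] + ½[β,[β, quad_W]] + ½[c, quad_W]` (`Ad` is an algebra automorphism).
[folklore] -/
theorem qtwist₂Aux_shift (β c : 𝔸) (L : List (Bool × 𝔸)) :
    qtwist₂Aux 𝕜 β c L = qtwist₂Aux 𝕜 0 0 L + br β (qtwistAux 𝕜 0 L)
      + (2 : 𝕜)⁻¹ • br β (br β (quad 𝕜 (wpart L))) + (2 : 𝕜)⁻¹ • br c (quad 𝕜 (wpart L)) := by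
  induction L generalizing β c with
  | nil => simp [br]
  | cons p L ih =>
    obtain ⟨t, z⟩ := p
    cases t
    · rw [qtwist₂Aux_consB, qtwist₂Aux_consB, ih (β + z) (c + br β z), ih (0 + z) (0 + br 0 z), qtwistAux_consB,
        qtwistAux_shift 𝕜 (0 + z) L, wpart_consB]
      simp only [br, mul_add, add_mul, mul_sub, sub_mul, smul_add, smul_sub,
        mul_assoc, zero_mul, mul_zero, sub_zero, zero_add, add_zero, smul_zero]
      module
    · rw [qtwist₂Aux_consW, qtwist₂Aux_consW, ih β c, twist₂Aux_shift 𝕜 β c L, twistAux_shift β L, qtwistAux_consW,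
        wpart_consW, quad_cons, ad₂_zero_zero]
      simp only [ad₂, br, mul_add, add_mul, mul_sub, sub_mul, smul_add, smul_sub, smul_mul_assoc, mul_smul_comm, smul_smul,
        mul_assoc, zero_mul, mul_zero, sub_zero, zero_add, add_zero, smul_zero]
      module

end Transport

/-! ## §2 Graded fourth-order components of an ordered product of exponential jets -/

section Graded

variable (𝕜 : Type*) [RCLike 𝕜] {𝔸 : Type*} [NormedRing 𝔸] [NormedAlgebra 𝕜 𝔸]

/-- THE FOURTH-ORDER TERM of the ordered product `Π_j (1 + b_j + b_j²/2 + b_j³/6 + b_j⁴/24 + ⋯)`, recursively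
`quartic (b :: l) = quartic l + b·cubic l + ½b²·quad l + ⅙b³·Σl + (1/24)b⁴`. [folklore] -/
def quartic : List 𝔸 → 𝔸
  | [] => 0
  | b :: l => quartic l + b * cubic 𝕜 l + (2 : 𝕜)⁻¹ • (b * b) * quad 𝕜 l + (6 : 𝕜)⁻¹ • (b * b * b) * l.sum
      + (24 : 𝕜)⁻¹ • (b * b * b * b)

/-- `quartic` of the empty list. [folklore] -/
@[simp] theorem quartic_nil : quartic 𝕜 ([] : List 𝔸) = 0 := rfl
/-- `quartic` recursion. [folklore] -/
@[simp] theorem quartic_cons (b : 𝔸) (l : List 𝔸) :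
    quartic 𝕜 (b :: l) = quartic 𝕜 l + b * cubic 𝕜 l + (2 : 𝕜)⁻¹ • (b * b) * quad 𝕜 l
      + (6 : 𝕜)⁻¹ • (b * b * b) * l.sum + (24 : 𝕜)⁻¹ • (b * b * b * b) := rfl

/-- THE `(3,1)`-COMPONENT (W-degree three, B-degree one). [folklore] -/
def P31 : List (Bool × 𝔸) → 𝔸
  | [] => 0
  | (true, x) :: L => P31 L + x * P21 𝕜 L + (2 : 𝕜)⁻¹ • (x * x) * P11 L + (6 : 𝕜)⁻¹ • (x * x * x) * (bpart L).sum
  | (false, y) :: L => P31 L + y * cubic 𝕜 (wpart L)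

/-- `P31` of the empty word. [folklore] -/
@[simp] theorem P31_nil : P31 𝕜 ([] : List (Bool × 𝔸)) = 0 := rfl
/-- `P31`, W-letter first. [folklore] -/
@[simp] theorem P31_consW (x : 𝔸) (L : List (Bool × 𝔸)) :
    P31 𝕜 ((true, x) :: L) = P31 𝕜 L + x * P21 𝕜 L + (2 : 𝕜)⁻¹ • (x * x) * P11 L
      + (6 : 𝕜)⁻¹ • (x * x * x) * (bpart L).sum := rfl
/-- `P31`, B-letter first. [folklore] -/
@[simp] theorem P31_consB (y : 𝔸) (L : List (Bool × 𝔸)) :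
    P31 𝕜 ((false, y) :: L) = P31 𝕜 L + y * cubic 𝕜 (wpart L) := rfl

/-- **THE `(2,2)`-COMPONENT** (W-degree two, B-degree two) of the ordered product of exponential jets — THE OBJECT OF THIS FILE:
`P22 ((W,x) :: L) = P22 L + x·P12 L + ½x²·quad(bpart L)`, `P22 ((B,y) :: L) = P22 L + y·P21 L + ½y²·quad(wpart L)`. [folklore] -/
def P22 : List (Bool × 𝔸) → 𝔸
  | [] => 0
  | (true, x) :: L => P22 L + x * P12 𝕜 L + (2 : 𝕜)⁻¹ • (x * x) * quad 𝕜 (bpart L)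
  | (false, y) :: L => P22 L + y * P21 𝕜 L + (2 : 𝕜)⁻¹ • (y * y) * quad 𝕜 (wpart L)

/-- `P22` of the empty word. [folklore] -/
@[simp] theorem P22_nil : P22 𝕜 ([] : List (Bool × 𝔸)) = 0 := rfl
/-- `P22`, W-letter first: `+ x·P12 L + ½x²·quad_B`. [folklore] -/
@[simp] theorem P22_consW (x : 𝔸) (L : List (Bool × 𝔸)) :
    P22 𝕜 ((true, x) :: L) = P22 𝕜 L + x * P12 𝕜 L + (2 : 𝕜)⁻¹ • (x * x) * quad 𝕜 (bpart L) := rfl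
/-- `P22`, B-letter first: `+ y·P21 L + ½y²·quad_W`. [folklore] -/
@[simp] theorem P22_consB (y : 𝔸) (L : List (Bool × 𝔸)) :
    P22 𝕜 ((false, y) :: L) = P22 𝕜 L + y * P21 𝕜 L + (2 : 𝕜)⁻¹ • (y * y) * quad 𝕜 (wpart L) := rfl

/-- THE `(1,3)`-COMPONENT (W-degree one, B-degree three), the mirror image of `P31`. [folklore] -/
def P13 : List (Bool × 𝔸) → 𝔸
  | [] => 0
  | (true, x) :: L => P13 L + x * cubic 𝕜 (bpart L)
  | (false, y) :: L => P13 L + y * P12 𝕜 L + (2 : 𝕜)⁻¹ • (y * y) * P11 L + (6 : 𝕜)⁻¹ • (y * y * y) * (wpart L).sum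

/-- `P13` of the empty word. [folklore] -/
@[simp] theorem P13_nil : P13 𝕜 ([] : List (Bool × 𝔸)) = 0 := rfl
/-- `P13`, W-letter first. [folklore] -/
@[simp] theorem P13_consW (x : 𝔸) (L : List (Bool × 𝔸)) :
    P13 𝕜 ((true, x) :: L) = P13 𝕜 L + x * cubic 𝕜 (bpart L) := rfl
/-- `P13`, B-letter first. [folklore] -/
@[simp] theorem P13_consB (y : 𝔸) (L : List (Bool × 𝔸)) :
    P13 𝕜 ((false, y) :: L) = P13 𝕜 L + y * P12 𝕜 L + (2 : 𝕜)⁻¹ • (y * y) * P11 L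
      + (6 : 𝕜)⁻¹ • (y * y * y) * (wpart L).sum := rfl

/-- degree four, POLARISED: `quartic (scaled word) = σ⁴·quartic (wpart) + σ³τ·P31 + σ²τ²·P22 + στ³·P13 + τ⁴·quartic (bpart)` —
`P22` IS the bidegree-`(2,2)` Taylor coefficient of the fourth-order term of the ordered product of exponential jets (and by
`D₄_zero` below, of the product of exponentials itself). [folklore] -/
theorem quartic_map_scale (σ τ : 𝕜) (L : List (Bool × 𝔸)) :
    quartic 𝕜 (L.map (scale 𝕜 σ τ)) =
      σ ^ 4 • quartic 𝕜 (wpart L) + (σ ^ 3 * τ) • P31 𝕜 L + (σ ^ 2 * τ ^ 2) • P22 𝕜 L + (σ * τ ^ 3) • P13 𝕜 L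
        + τ ^ 4 • quartic 𝕜 (bpart L) := by
  induction L with
  | nil => simp
  | cons p L ih =>
    obtain ⟨t, z⟩ := p
    cases t
    · simp only [List.map_cons, scale_B, quartic_cons, ih, cubic_map_scale, quad_map_scale, sum_map_scale, wpart_consB,
        bpart_consB, P31_consB, P22_consB, P13_consB, smul_add, mul_add, smul_mul_assoc, mul_smul_comm, smul_smul, pow_succ,
        pow_zero, one_mul, mul_assoc]
      module
    · simp only [List.map_cons, scale_W, quartic_cons, ih, cubic_map_scale, quad_map_scale, sum_map_scale, wpart_consW,
        bpart_consW, P31_consW, P22_consW, P13_consW, smul_add, mul_add, smul_mul_assoc, mul_smul_comm, smul_smul, pow_succ,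
        pow_zero, one_mul, mul_assoc]
      module

/-- EXTRACTION: the `(2,2)`-component from three rays — `P22 = ½(quartic(W+B) + quartic(W−B)) − quartic(W) − quartic(B)`. [folklore] -/
theorem P22_eq_rays (L : List (Bool × 𝔸)) :
    P22 𝕜 L = (2 : 𝕜)⁻¹ • (quartic 𝕜 (L.map (scale 𝕜 1 1)) + quartic 𝕜 (L.map (scale 𝕜 1 (-1))))
      - quartic 𝕜 (wpart L) - quartic 𝕜 (bpart L) := by
  rw [quartic_map_scale, quartic_map_scale]
  module

end Graded

/-! ## §3 THE TRANSPORT FACTORISATION of the graded components (ring identities, no trace) -/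

section Factorisation

variable (𝕜 : Type*) [RCLike 𝕜] {𝔸 : Type*} [NormedRing 𝔸] [NormedAlgebra 𝕜 𝔸]

/-- **`P21` IN CLOSED FORM (ring identity):** `P21 L = qtwist L + quad(wpart L) · Z_B` — the `(2,1)`-component is the `B`-linear part of
`quad` of the TRANSPORTED fluctuation letters plus `quad` of the bare ones times the background holonomy's first-order term; this refines the
trace-level normal form `WilsonVertex.trace_P21` to an identity in the algebra. [folklore] -/
theorem P21_eq_transport (L : List (Bool × 𝔸)) :
    P21 𝕜 L = qtwistAux 𝕜 0 L + quad 𝕜 (wpart L) * (bpart L).sum := by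
  induction L with
  | nil => simp
  | cons p L ih =>
    obtain ⟨t, z⟩ := p
    cases t
    · rw [P21_consB, ih, qtwistAux_consB, qtwistAux_shift 𝕜 (0 + z) L, wpart_consB, bpart_consB, List.sum_cons]
      simp only [br, mul_add,
        zero_add]
      module
    · rw [P21_consW, ih, P11_eq, qtwistAux_consW, wpart_consW, bpart_consW, quad_cons]
      simp only [br, mul_add, add_mul, smul_mul_assoc,
        mul_assoc, zero_mul, mul_zero, sub_zero, zero_add, add_zero, smul_zero]
      module

/-- **`P12` IN CLOSED FORM (ring identity):** `P12 L = twist₂ L + twist L · Z_B + Z_W · quad(bpart L)` — second-order transport, first-order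
transport times the holonomy's first-order term, bare letters times its second-order term. [folklore] -/
theorem P12_eq_transport (L : List (Bool × 𝔸)) :
    P12 𝕜 L = twist₂Aux 𝕜 0 0 L + twistAux 0 L * (bpart L).sum + (wpart L).sum * quad 𝕜 (bpart L) := by
  induction L with
  | nil => simp
  | cons p L ih =>
    obtain ⟨t, z⟩ := p
    cases t
    · rw [P12_consB, ih, P11_eq, twist₂Aux_consB, twist₂Aux_shift 𝕜 (0 + z) (0 + br 0 z) L, twistAux_consB,
        twistAux_shift (0 + z) L, wpart_consB, bpart_consB, List.sum_cons, quad_cons]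
      simp only [br, mul_add, add_mul, mul_sub, sub_mul, smul_sub, smul_mul_assoc, mul_smul_comm,
        mul_assoc, zero_mul, mul_zero, sub_zero, zero_add, add_zero, smul_zero]
      module
    · rw [P12_consW, ih, twist₂Aux_consW, twistAux_consW_br, wpart_consW, bpart_consW, List.sum_cons, ad₂_zero_zero]
      simp only [br, add_mul, zero_mul, mul_zero, sub_zero, zero_add]
      abel

/-- **THE TRANSPORT FACTORISATION OF THE `(2,2)`-COMPONENT (ring identity, the object of this file):**
`P22 L = qtwist₂ L + qtwist L · Z_B + quad(wpart L) · quad(bpart L)` — the bidegree-`(2,2)` shadow of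
`Π_j e^{z_j} = (Π_i e^{Ad(h_i)x_i}) · h`, `h = e^{y₁}⋯e^{y_m}` the background holonomy of the word and `h_i` the holonomy of the prefix of
the `i`-th fluctuation letter: (second order of the transported `quad`)·1 + (its first order)·(h)₁ + (its zeroth order)·(h)₂.  Proved by
induction on the word from the recursions — no BCH, no exponentials, every ring. [folklore] -/
theorem P22_eq_transport (L : List (Bool × 𝔸)) :
    P22 𝕜 L = qtwist₂Aux 𝕜 0 0 L + qtwistAux 𝕜 0 L * (bpart L).sum + quad 𝕜 (wpart L) * quad 𝕜 (bpart L) := by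
  induction L with
  | nil => simp
  | cons p L ih =>
    obtain ⟨t, z⟩ := p
    cases t
    · rw [P22_consB, ih, P21_eq_transport, qtwist₂Aux_consB, qtwist₂Aux_shift 𝕜 (0 + z) (0 + br 0 z) L, qtwistAux_consB,
        qtwistAux_shift 𝕜 (0 + z) L, wpart_consB, bpart_consB, List.sum_cons, quad_cons]
      simp only [br, mul_add, add_mul, mul_sub, sub_mul, smul_sub, smul_mul_assoc, mul_smul_comm,
        mul_assoc, zero_mul, mul_zero, sub_zero, zero_add, add_zero, smul_zero]
      module
    · rw [P22_consW, ih, P12_eq_transport, qtwist₂Aux_consW, qtwistAux_consW, wpart_consW, bpart_consW, quad_cons,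
        ad₂_zero_zero]
      simp only [br, mul_add, add_mul, smul_mul_assoc,
        mul_assoc, zero_mul, mul_zero, sub_zero, zero_add, add_zero, smul_zero]
      module

end Factorisation

/-! ## §4 THE GRADED FOURTH-ORDER TRACE FORMULA -/

section Trace

variable (𝕜 : Type*) [RCLike 𝕜] {𝔸 : Type*} [NormedRing 𝔸] [NormedAlgebra 𝕜 𝔸]
variable {V : Type*} [AddCommGroup V] [Module 𝕜 V]

/-- UNDER A TRACE the polarised `quad` of the transported letters collapses: `τ(qtwistAux β L) = τ(Z_W · twistAux β L)`. [folklore] -/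
theorem trace_qtwistAux (τ : 𝔸 →ₗ[𝕜] V) (hτ : ∀ a b : 𝔸, τ (a * b) = τ (b * a)) (β : 𝔸) (L : List (Bool × 𝔸)) :
    τ (qtwistAux 𝕜 β L) = τ ((wpart L).sum * twistAux β L) := by
  induction L generalizing β with
  | nil => simp
  | cons p L ih =>
    obtain ⟨t, z⟩ := p
    cases t
    · rw [qtwistAux_consB, twistAux_consB, wpart_consB]
      exact ih (β + z)
    · rw [qtwistAux_consW, twistAux_consW_br, wpart_consW, List.sum_cons]
      simp only [map_add, map_smul, mul_add, add_mul, smul_add]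
      rw [ih β, hτ (br β z) (wpart L).sum, hτ (br β z) z]
      module

/-- UNDER A TRACE: `τ(qtwist₂Aux β c L) = τ(Z_W · twist₂Aux β c L) + ½τ((twistAux β L)²)` — the cross terms `A⁽²⁾_i x_{i'}` collapse onto
`Z_W`, the `A⁽¹⁾A⁽¹⁾` terms are `quad` of the first-order transports, whose trace is half the square of their sum (`two_smul_quad`; the
commutator sum is traceless). [folklore] -/
theorem trace_qtwist₂Aux (τ : 𝔸 →ₗ[𝕜] V) (hτ : ∀ a b : 𝔸, τ (a * b) = τ (b * a)) (β c : 𝔸) (L : List (Bool × 𝔸)) :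
    τ (qtwist₂Aux 𝕜 β c L) =
      τ ((wpart L).sum * twist₂Aux 𝕜 β c L) + (2 : 𝕜)⁻¹ • τ (twistAux β L * twistAux β L) := by
  induction L generalizing β c with
  | nil => simp
  | cons p L ih =>
    obtain ⟨t, z⟩ := p
    cases t
    · rw [qtwist₂Aux_consB, twist₂Aux_consB, twistAux_consB, wpart_consB]
      exact ih (β + z) (c + br β z)
    · rw [qtwist₂Aux_consW, twist₂Aux_consW, twistAux_consW_br, wpart_consW, List.sum_cons]
      simp only [map_add, map_smul, mul_add, add_mul, smul_add]
      rw [ih β c, hτ (ad₂ 𝕜 β c z) (wpart L).sum, hτ (ad₂ 𝕜 β c z) z, hτ (twistAux β L) (br β z)]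
      module

/-- **THE GRADED FOURTH-ORDER TRACE FORMULA.**  For every two-sorted word `L` and every TRACIAL linear `τ`:
`τ(P22 L) = τ(Z_W · twist₂ L) + ½·τ((twist L)²) + τ(qtwist L · Z_B) + τ(quad(wpart L) · quad(bpart L))` —
SECOND-ORDER TRANSPORT + TRANSPORT² + TRANSPORTED `quad` AGAINST THE BACKGROUND CURL + `quad × quad`
(`Z_W = Σ wpart L`, `Z_B = Σ bpart L`, `twist = WilsonVertex.twistAux 0`, `2·quad = Z² + commSum`). [folklore] -/
theorem trace_P22 (τ : 𝔸 →ₗ[𝕜] V) (hτ : ∀ a b : 𝔸, τ (a * b) = τ (b * a)) (L : List (Bool × 𝔸)) :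
    τ (P22 𝕜 L) =
      τ ((wpart L).sum * twist₂Aux 𝕜 0 0 L) + (2 : 𝕜)⁻¹ • τ (twistAux 0 L * twistAux 0 L)
        + τ (qtwistAux 𝕜 0 L * (bpart L).sum) + τ (quad 𝕜 (wpart L) * quad 𝕜 (bpart L)) := by
  rw [P22_eq_transport, map_add, map_add, trace_qtwist₂Aux 𝕜 τ hτ 0 0 L]

/-- the third-order companion: `τ(P21 L) = τ(Z_W · twist L) + τ(quad(wpart L) · Z_B)` — the normal form of `WilsonVertex.trace_P21`
(there: `½τ(Z_W²Z_B) + ½τ(Z_B·commSum) + τ(Z_W·twist)`) regrouped by `2·quad = Z² + commSum`. [folklore] -/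
theorem trace_P21_transport (τ : 𝔸 →ₗ[𝕜] V) (hτ : ∀ a b : 𝔸, τ (a * b) = τ (b * a)) (L : List (Bool × 𝔸)) :
    τ (P21 𝕜 L) = τ ((wpart L).sum * twistAux 0 L) + τ (quad 𝕜 (wpart L) * (bpart L).sum) := by
  rw [P21_eq_transport, map_add, trace_qtwistAux 𝕜 τ hτ 0 L]

end Trace

/-! ## §5 The Wilson plaquette word: the `(2,2)`-jet of `tr U(∂p)` -/

section Plaquette

variable (𝕜 : Type*) [RCLike 𝕜] {𝔸 : Type*} [NormedRing 𝔸] [NormedAlgebra 𝕜 𝔸]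
variable {V : Type*} [AddCommGroup V] [Module 𝕜 V]
variable (W₁ W₂ W₃ W₄ B₁ B₂ B₃ B₄ : 𝔸)

/-- THE SECOND-ORDER TRANSPORT SUM OF THE PLAQUETTE WORD `e^{W₁}e^{B₁}e^{W₂}e^{B₂}e^{−B₃}e^{−W₃}e^{−B₄}e^{−W₄}`: the three later fluctuation
letters transported to second order by their background prefixes — `W₂` by `(β, c) = (B₁, 0)`, `−W₃` by
`(B₁ + B₂ − B₃, [B₁,B₂] − [B₁ + B₂, B₃])`, `−W₄` by `(B₁ + B₂ − B₃ − B₄, [B₁,B₂] − [B₁+B₂,B₃] − [B₁+B₂−B₃,B₄])`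
(the `c` are the ordered commutator sums of the prefixes, `TransportVertices.commSum`). [folklore] -/
theorem twist₂_plaq : twist₂Aux 𝕜 0 0 (plaq W₁ W₂ W₃ W₄ B₁ B₂ B₃ B₄) =
    ad₂ 𝕜 B₁ 0 W₂ - ad₂ 𝕜 (B₁ + B₂ - B₃) (br B₁ B₂ - br (B₁ + B₂) B₃) W₃
      - ad₂ 𝕜 (B₁ + B₂ - B₃ - B₄) (br B₁ B₂ - br (B₁ + B₂) B₃ - br (B₁ + B₂ - B₃) B₄) W₄ := by
  simp only [plaq, twist₂Aux_consW, twist₂Aux_consB, twist₂Aux_nil]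
  simp only [ad₂, br, mul_add, add_mul, mul_sub, sub_mul, smul_add, smul_sub,
    mul_assoc, zero_mul, mul_zero, sub_zero, zero_add, add_zero, smul_zero, neg_mul, mul_neg, neg_neg, smul_neg]
  module

/-- THE TRANSPORTED-`quad` SUM OF THE PLAQUETTE WORD, explicitly: with the signed letters `x = (W₁, W₂, −W₃, −W₄)` and their first-order
transports `A = (0, [B₁,W₂], −[B₁+B₂−B₃, W₃], −[B₁+B₂−B₃−B₄, W₄])`,
`qtwist = Σ_{i<i'} (A_i x_{i'} + x_i A_{i'}) + ½Σ_i (A_i x_i + x_i A_i)`. [folklore] -/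
theorem qtwist_plaq : qtwistAux 𝕜 0 (plaq W₁ W₂ W₃ W₄ B₁ B₂ B₃ B₄) =
    W₁ * (br B₁ W₂ - br (B₁ + B₂ - B₃) W₃ - br (B₁ + B₂ - B₃ - B₄) W₄)
      + (br B₁ W₂ * (-W₃ - W₄) + W₂ * (-br (B₁ + B₂ - B₃) W₃ - br (B₁ + B₂ - B₃ - B₄) W₄))
      + (br (B₁ + B₂ - B₃) W₃ * W₄ + W₃ * br (B₁ + B₂ - B₃ - B₄) W₄)
      + (2 : 𝕜)⁻¹ • ((br B₁ W₂ * W₂ + W₂ * br B₁ W₂)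
          + (br (B₁ + B₂ - B₃) W₃ * W₃ + W₃ * br (B₁ + B₂ - B₃) W₃)
          + (br (B₁ + B₂ - B₃ - B₄) W₄ * W₄ + W₄ * br (B₁ + B₂ - B₃ - B₄) W₄)) := by
  simp only [plaq, qtwistAux_consW, qtwistAux_consB, qtwistAux_nil, twistAux_consW_br, twistAux_consB, twistAux_nil,
    wpart_consW, wpart_consB, wpart_nil, List.sum_cons, List.sum_nil]
  simp only [br, mul_add, add_mul, mul_sub, sub_mul, smul_add, smul_sub,
    mul_assoc, zero_mul, mul_zero, sub_zero, zero_add, add_zero, smul_zero, neg_mul, mul_neg, neg_neg, smul_neg,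
    neg_zero]
  module

/-- **THE `(2,2)`-JET OF `tr U(∂p)`** for every tracial linear `τ` — the plaquette instance of `trace_P22`:
`τ(curl W · twist₂) + ½τ(twist²) + τ(qtwist · curl B) + τ(quad_W · quad_B)`, with the curls `W₁ + W₂ − W₃ − W₄`, `B₁ + B₂ − B₃ − B₄`,
`twist = WilsonVertex.twist_plaq`, `twist₂ = twist₂_plaq`, `qtwist = qtwist_plaq` and `2·quad_W = (curl W)² + plaqPairs W₁ W₄ W₃ W₂`
(`two_smul_quad`, `commSum_wpart_plaq`; likewise for `B`).  Exact, BCH-free, every ring. [folklore] -/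
theorem trace_P22_plaq (τ : 𝔸 →ₗ[𝕜] V) (hτ : ∀ a b : 𝔸, τ (a * b) = τ (b * a)) :
    τ (P22 𝕜 (plaq W₁ W₂ W₃ W₄ B₁ B₂ B₃ B₄)) =
      τ ((W₁ + W₂ - W₃ - W₄) * (ad₂ 𝕜 B₁ 0 W₂ - ad₂ 𝕜 (B₁ + B₂ - B₃) (br B₁ B₂ - br (B₁ + B₂) B₃) W₃
          - ad₂ 𝕜 (B₁ + B₂ - B₃ - B₄) (br B₁ B₂ - br (B₁ + B₂) B₃ - br (B₁ + B₂ - B₃) B₄) W₄))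
        + (2 : 𝕜)⁻¹ • τ (((B₁ * W₂ - W₂ * B₁) - ((B₁ + B₂ - B₃) * W₃ - W₃ * (B₁ + B₂ - B₃))
              - ((B₁ + B₂ - B₃ - B₄) * W₄ - W₄ * (B₁ + B₂ - B₃ - B₄)))
            * ((B₁ * W₂ - W₂ * B₁) - ((B₁ + B₂ - B₃) * W₃ - W₃ * (B₁ + B₂ - B₃))
              - ((B₁ + B₂ - B₃ - B₄) * W₄ - W₄ * (B₁ + B₂ - B₃ - B₄))))
        + τ (qtwistAux 𝕜 0 (plaq W₁ W₂ W₃ W₄ B₁ B₂ B₃ B₄) * (B₁ + B₂ - B₃ - B₄))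
        + τ (quad 𝕜 [W₁, W₂, -W₃, -W₄] * quad 𝕜 [B₁, B₂, -B₃, -B₄]) := by
  rw [trace_P22 𝕜 τ hτ, wpart_plaq, bpart_plaq, sum_four_signed, sum_four_signed, twist_plaq, twist₂_plaq]

/-- `quad` of a boundary word with constant letters `(X, Y, −X, −Y)` is the one commutator `[X, Y]` (curl zero, `plaqPairs_local`).
[folklore] -/
theorem quad_four_const (X Y : 𝔸) : quad 𝕜 [X, Y, -X, -Y] = br X Y := by
  have h := two_smul_quad 𝕜 [X, Y, -X, -Y]
  rw [sum_four_signed, commSum_wpart_plaq X Y X Y, plaqPairs_local] at h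
  have h0 : X + Y - X - Y = 0 := by abel
  rw [h0, zero_mul, zero_add] at h
  calc quad 𝕜 [X, Y, -X, -Y] = (2 : 𝕜)⁻¹ • ((2 : 𝕜) • quad 𝕜 [X, Y, -X, -Y]) := by
        rw [smul_smul, inv_mul_cancel₀ (two_ne_zero' 𝕜), one_smul]
    _ = br X Y := by
        rw [h, two_mul, ← two_smul 𝕜 (br X Y), smul_smul, inv_mul_cancel₀ (two_ne_zero' 𝕜), one_smul]

/-- **THE CONSTANT-FIELD CHECK.**  At CONSTANT letters — fluctuation `(W₁,W₂,W₃,W₄) = (X,Y,X,Y)`, background `(B₁,B₂,B₃,B₄) = (P,Q,P,Q)`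
— both curls vanish and the `(2,2)`-jet of `τ U(∂p)` is `½τ(([P,Y] − [Q,X])²) + τ([X,Y]·[P,Q])`: EXACTLY the bidegree-`(2,2)` part of
`½τ(F²)` for the commutator field strength `F = [P + X, Q + Y] = [P,Q] + ([P,Y] − [Q,X]) + [X,Y]` of the constant connection `B + W`
(seagull² + spin × spin).  A consistency statement derived from the group product; no continuum claim. [folklore] -/
theorem trace_P22_plaq_const (τ : 𝔸 →ₗ[𝕜] V) (hτ : ∀ a b : 𝔸, τ (a * b) = τ (b * a)) (X Y P Q : 𝔸) :
    τ (P22 𝕜 (plaq X Y X Y P Q P Q)) =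
      (2 : 𝕜)⁻¹ • τ ((br P Y - br Q X) * (br P Y - br Q X)) + τ (br X Y * br P Q) := by
  rw [trace_P22 𝕜 τ hτ, wpart_plaq, bpart_plaq, sum_four_signed, sum_four_signed, twist_plaq, quad_four_const,
    quad_four_const]
  have h0 : X + Y - X - Y = 0 := by abel
  have h0' : P + Q - P - Q = 0 := by abel
  have ht : (P * Y - Y * P) - ((P + Q - P) * X - X * (P + Q - P)) - ((P + Q - P - Q) * Y - Y * (P + Q - P - Q))
      = br P Y - br Q X := by
    simp only [br]; noncomm_ring
  rw [ht, h0, h0']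
  simp only [zero_mul, mul_zero, map_zero, zero_add, add_zero]

end Plaquette

/-! ## §6 Identification: `quartic` is one twenty-fourth of the fourth derivative of the transport path -/

section Calculus

variable (𝕜 : Type*) [RCLike 𝕜] {𝔸 : Type*} [NormedRing 𝔸] [NormedAlgebra 𝕜 𝔸] [CompleteSpace 𝔸]

/-- Fourth derivative of the transport path `t ↦ Π_j exp(t b_j)` (recursive Leibniz form, continuing `D₁`, `D₂` of
`Beta.TransportVertices` and `D₃` of `Beta.WilsonVertex`; binomial multiplicities written as repeated summands). [folklore] -/
def D₄ : List 𝔸 → 𝕜 → 𝔸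
  | [], _ => 0
  | b :: l, t => b * (b * (b * (b * exp (t • b)))) * holPath 𝕜 l t
      + (b * (b * (b * exp (t • b))) * D₁ 𝕜 l t + b * (b * (b * exp (t • b))) * D₁ 𝕜 l t
          + b * (b * (b * exp (t • b))) * D₁ 𝕜 l t + b * (b * (b * exp (t • b))) * D₁ 𝕜 l t)
      + (b * (b * exp (t • b)) * D₂ 𝕜 l t + b * (b * exp (t • b)) * D₂ 𝕜 l t + b * (b * exp (t • b)) * D₂ 𝕜 l t
          + b * (b * exp (t • b)) * D₂ 𝕜 l t + b * (b * exp (t • b)) * D₂ 𝕜 l t + b * (b * exp (t • b)) * D₂ 𝕜 l t)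
      + (b * exp (t • b) * D₃ 𝕜 l t + b * exp (t • b) * D₃ 𝕜 l t + b * exp (t • b) * D₃ 𝕜 l t
          + b * exp (t • b) * D₃ 𝕜 l t)
      + exp (t • b) * D₄ l t

/-- `D₃ l` is differentiable with derivative `D₄ l t`. [folklore] -/
theorem hasDerivAt_D₃ (l : List 𝔸) (t : 𝕜) : HasDerivAt (D₃ 𝕜 l) (D₄ 𝕜 l t) t := by
  induction l with
  | nil =>
    have h : D₃ 𝕜 ([] : List 𝔸) = fun _ => 0 := by funext u; simp [D₃]
    rw [h]
    simpa [D₄] using hasDerivAt_const t (0 : 𝔸)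
  | cons b l ih =>
    have hD : D₃ 𝕜 (b :: l) = fun u =>
        b * (b * (b * exp (u • b))) * holPath 𝕜 l u
          + (b * (b * exp (u • b)) * D₁ 𝕜 l u + b * (b * exp (u • b)) * D₁ 𝕜 l u + b * (b * exp (u • b)) * D₁ 𝕜 l u)
          + (b * exp (u • b) * D₂ 𝕜 l u + b * exp (u • b) * D₂ 𝕜 l u + b * exp (u • b) * D₂ 𝕜 l u)
          + exp (u • b) * D₃ 𝕜 l u := by
      funext u; simp [D₃]
    rw [hD]
    have hE : HasDerivAt (fun u : 𝕜 => exp (u • b)) (b * exp (t • b)) t := hasDerivAt_exp_smul_const' b t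
    have h1 : HasDerivAt (fun u : 𝕜 => b * exp (u • b)) (b * (b * exp (t • b))) t := hE.const_mul b
    have h2 : HasDerivAt (fun u : 𝕜 => b * (b * exp (u • b))) (b * (b * (b * exp (t • b)))) t := h1.const_mul b
    have h3 : HasDerivAt (fun u : 𝕜 => b * (b * (b * exp (u • b)))) (b * (b * (b * (b * exp (t • b))))) t :=
      h2.const_mul b
    have h := (((h3.mul (hasDerivAt_holPath 𝕜 l t)).add
      (((h2.mul (hasDerivAt_D₁ 𝕜 l t)).add (h2.mul (hasDerivAt_D₁ 𝕜 l t))).add (h2.mul (hasDerivAt_D₁ 𝕜 l t)))).add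
      (((h1.mul (hasDerivAt_D₂ 𝕜 l t)).add (h1.mul (hasDerivAt_D₂ 𝕜 l t))).add (h1.mul (hasDerivAt_D₂ 𝕜 l t)))).add
      (hE.mul ih)
    refine h.congr_deriv ?_
    simp only [D₄]
    noncomm_ring

omit [CompleteSpace 𝔸] in
/-- **FOURTH VARIATION AT ZERO BACKGROUND: `(d⁴/dt⁴)|₀ Π_j exp(t b_j) = 24 · quartic [b₁,…,b_n]`** — `quartic` IS the fourth-order Taylor
term of the ordered product of exponentials (with `quartic_map_scale`: `P22` is the `σ²τ²`-coefficient along the ray `(σW, τB)`, i.e.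
the `(2,2)` Taylor coefficient). [folklore] -/
theorem D₄_zero (l : List 𝔸) : D₄ 𝕜 l 0 = (24 : 𝕜) • quartic 𝕜 l := by
  induction l with
  | nil => simp [D₄]
  | cons b l ih =>
    have h2 : D₂ 𝕜 l 0 = (2 : 𝕜) • quad 𝕜 l := D₂_zero_eq_two_smul_quad 𝕜 l
    have h3 : D₃ 𝕜 l 0 = (6 : 𝕜) • cubic 𝕜 l := D₃_zero 𝕜 l
    simp only [D₄, zero_smul, exp_zero, holPath_zero, D₁_zero, h2, h3, ih, quartic_cons, mul_one, one_mul, smul_add,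
      mul_smul_comm, smul_mul_assoc, smul_smul, mul_assoc]
    rw [show (24 : 𝕜) * (2 : 𝕜)⁻¹ = 12 by norm_num, show (24 : 𝕜) * (6 : 𝕜)⁻¹ = 4 by norm_num,
      show (24 : 𝕜) * (24 : 𝕜)⁻¹ = 1 by norm_num, one_smul]
    module

/-- the fourth-order summary at zero background: `HasDerivAt (D₃ l) (24 · quartic l) 0`. [folklore] -/
theorem hasDerivAt_D₃_zero (l : List 𝔸) : HasDerivAt (D₃ 𝕜 l) ((24 : 𝕜) • quartic 𝕜 l) 0 := by
  simpa [D₄_zero] using hasDerivAt_D₃ 𝕜 l 0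

end Calculus

/-! ## Examples -/

section Examples

variable {𝔸 : Type*} [NormedRing 𝔸] [NormedAlgebra ℝ 𝔸]

/-- Two letters, fluctuation first: the `(2,2)`-component of `e^x e^y` is `½x² · ½y²`. [folklore] -/
example (x y : 𝔸) : P22 ℝ [(true, x), (false, y)] = (2 : ℝ)⁻¹ • (x * x) * ((2 : ℝ)⁻¹ • (y * y)) := by
  simp [P22, P12, quad_cons]

/-- Two letters, background first: the `(2,2)`-component of `e^y e^x` is `½y² · ½x²`. [folklore] -/
example (x y : 𝔸) : P22 ℝ [(false, y), (true, x)] = (2 : ℝ)⁻¹ • (y * y) * ((2 : ℝ)⁻¹ • (x * x)) := by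
  simp [P22, P21, P11, quad_cons]

/-- The second-order transport of `x` behind one background letter `y` is `½[y,[y,x]]` — the second Taylor term of `e^{y} x e^{−y}`.
[folklore] -/
example (x y : 𝔸) : twist₂Aux ℝ 0 0 [(false, y), (true, x)] = (2 : ℝ)⁻¹ • br y (br y x) := by
  simp [twist₂Aux, ad₂, br]

/-- With the fluctuation letter in front of the background there is no transport at any order. [folklore] -/
example (x y : 𝔸) : twist₂Aux ℝ 0 0 [(true, x), (false, y)] = 0 ∧ qtwistAux ℝ 0 [(true, x), (false, y)] = 0 := by
  constructor <;> simp [br]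

end Examples

end Literature.MathematicalPhysics.QuantumFieldTheory.Balaban1983to89.Beta.WilsonVertex2
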